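import Summits.AtomisticToContinuum.HydrodynamicLimit.Theorems.CorrectorPressureDecay.Negative.AmplitudeWitness

/-!
# Negative knowledge for `CorrectorPressureDecay` (stmt-AtomisticToContinuum-14135), IV: the amplitude clause `∃κ` is load-bearing

From the standing disprover's `Cruxes/CorrectorPressureDecay/Disproof.lean` §(a.2)
(refuter-cdisprove-stmt-AtomisticToContinuum-14135-0). `CorrectorPressureDecayAllAmplitudes` is the crux
`AntiMazurCoboundaries.CorrectorPressureDecay` with the clause `∃ κ > 0, ∀ φ g, … (∀ v, |g v| ≤ κ) …` replaced by
`∀ φ g, … (∃ K, ∀ v, |g v| ≤ K) …` (every BOUNDED continuous admissible `g`; the frame of the route's rung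
BoltzmannGreenKubo, stmt-13985) — it trivially implies the crux (`κ = 1`) — and it is FALSE, unconditionally. This is
the energy-shell Donsker–Varadhan floor of the earlier refuter passes ("`∃κ` is necessary, κ < 0.489 for a two-level
radial g") as a theorem, with a witness that needs no Gaussian integral evaluated:

* `hW` — a RADIAL admissible observable equal to `1` on the unit ball: `1 − a·tent_{5/2}(|v|²) − b·tent_{9/2}(|v|²)`
  with `(a, b)` solving `E h = 0`, `E |v|² h = 0` (determinant `≥ e₁ e₂ > 0` from the supports of the tents);
  `hW ⊥ v` by reflection evenness, so `hW ⊥ span(1, v, |v|²)` (`hW_orthogonal`), `|hW| ≤ H := 1 + |a| + |b|`;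
* witness of falsity: `a = θ = 1`, `u₀ = 0`, `φ ≡ 1`, `g = K·hW`, `δ = 1`, `K = 2 − 2 log q`, `q = γ{|v|² < η}`,
  `η = 1/(2(1+H))`; the low-energy band `B = {E ≤ (N+1)η/2}` is `Φ_lag`-invariant `G_N`-a.e. (energy conservation on
  the good set) with `G_N(B) ≥ q^{N+1}` (product formula), and on it `g(v) ≥ K − K(1+H)|v|²` per particle gives
  `2F ≥ K(N+1)`; Jensen for the normalised invariant law on `B` kills the coboundary:
  defect `≥ q^{N+1} e^{K(N+1)} = e^{(N+1)(2 − log q)} ≥ e^{2(N+1)} > e^{N+1}`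
  (`correctorPressureDecay_false_without_amplitude`). The prover's `κ < κ*` is exactly what removes this floor.
-/

noncomputable section

open MeasureTheory ProbabilityTheory Set Filter Topology
open scoped ENNReal

namespace Summit.AtomisticToContinuum.HydrodynamicLimit.Theorems.CorrectorPressureDecayNegative.Amplitude

open Literature.MathematicalPhysics.KineticTheory (T3 V3 hsDiameter localGibbsLaw localGibbsMeasure
  localGibbsProfile)
open Literature.Analysis.FluidPDE (HardSphereFlow Config configEnergy)

section AmplitudeRefutation

open Literature.MathematicalPhysics.KineticTheory

/-- `CorrectorPressureDecay` with the AMPLITUDE restriction removed: the clause `∃ κ > 0, ∀ φ g, … (∀ v, |g v| ≤ κ) …`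
becomes `∀ φ g, … (∃ K, ∀ v, |g v| ≤ K) …` — every bounded continuous admissible `g` (the frame of the route's
rung `BoltzmannGreenKubo`, stmt-13985, and of the L² items). All other tokens verbatim. -/
def CorrectorPressureDecayAllAmplitudes : Prop :=
  ∀ (a θ : ℝ) (u₀ : V3), 0 < a → 0 < θ → ∃ σ₀ : ℝ, 0 < σ₀ ∧ ∀ σ : ℝ, 0 < σ → σ < σ₀ →
    (∀ (N : ℕ) (Φ : HardSphereFlow (Literature.Analysis.FluidPDE.Torus.geometry (Fin 3)) (hsDiameter σ N) (N + 1)),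
      IsProbabilityMeasure (localGibbsLaw σ (fun _ => a) (fun _ => u₀) (fun _ => θ) N Φ)) ∧
    ∀ (φ : T3 → ℝ) (g : V3 → ℝ), Continuous φ → Continuous g → (∀ x, |φ x| ≤ 1) →
      (∃ K : ℝ, ∀ v, |g v| ≤ K) →
      (∀ (c₀ c₂ : ℝ) (b : V3), ∫ v, g v * (c₀ + inner ℝ b v + c₂ * ‖v‖ ^ 2) ∂stdGaussian V3 = 0) →
      ∀ δ : ℝ, 0 < δ → ∃ τ₀ : ℝ, 0 < τ₀ ∧ ∃ N₀ : ℕ, ∀ N : ℕ, N₀ ≤ N → ∀ Φ : HardSphereFlow (Literature.Analysis.FluidPDE.Torus.geometry (Fin 3)) (hsDiameter σ N) (N + 1),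
        ∃ lag : ℝ, 0 < lag ∧ ∃ W : Config (N + 1) (Fin 3) T3 → ℝ, Measurable W ∧ (∃ C : ℝ, ∀ z, |W z| ≤ C) ∧
          ∫⁻ z, ENNReal.ofReal (Real.exp (2 * ((∑ i, φ (z i).1 * g ((Real.sqrt θ)⁻¹ • ((z i).2 - u₀))) -
              lag⁻¹ * (W (Φ.flow lag z) - W z))))
            ∂(localGibbsLaw σ (fun _ => a) (fun _ => u₀) (fun _ => θ) N Φ) ≤
            ENNReal.ofReal (Real.exp (δ * (N + 1))) ∧
          ∫⁻ z, ENNReal.ofReal (Real.exp (4 * (τ₀ * ((N + 1 : ℕ) : ℝ) ^ (-(1 / 3 : ℝ)))⁻¹ * |W z|))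
            ∂(localGibbsLaw σ (fun _ => a) (fun _ => u₀) (fun _ => θ) N Φ) ≤
            ENNReal.ofReal (Real.exp (δ * (N + 1)))

/-- **Any proof of the crux must use the amplitude clause `∃κ` (`|g| ≤ κ` with `κ` the PROVER's).** With
`g` merely bounded the statement is FALSE. Witness: `a = θ = 1`, `u₀ = 0`, `φ ≡ 1`, `g = K·hW` (`hW` radial,
admissible, `= 1` on the unit ball, `|hW| ≤ H`), `δ = 1`, `K = 2 − 2 log q` where `q = γ{|v|² < η}`,
`η = 1/(2(1+H))`. The low-energy band `B = {E ≤ (N+1)η/2}` is `Φ_lag`-invariant `G_N`-a.e. (energy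
conservation on the good set) and has mass `≥ q^{N+1}` (it contains the product event `{∀ i, |vᵢ|² < η}`);
on `B`, `g(v) ≥ K − K(1+H)|v|²` per particle gives `2F ≥ K(N+1)`; conditional Jensen on `B` for the
`Φ_lag`-invariant normalised law kills the coboundary: defect `≥ q^{N+1} e^{K(N+1)} = e^{(N+1)(2 − log q)} ≥
e^{2(N+1)} > e^{N+1}`. (This is the energy-shell Donsker–Varadhan floor of the earlier refuter passes, as a theorem.) [folklore] -/
theorem correctorPressureDecay_false_without_amplitude : ¬ CorrectorPressureDecayAllAmplitudes := by
  intro h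
  obtain ⟨σ₀, hσ₀, hσ⟩ := h 1 1 0 one_pos one_pos
  set σ : ℝ := min (σ₀ / 2) 4⁻¹ with hσdef
  have hσpos : 0 < σ := lt_min (by linarith) (by norm_num)
  have hσlt : σ < σ₀ := (min_le_left _ _).trans_lt (by linarith)
  have hσhalf : σ < 2⁻¹ := (min_le_right _ _).trans_lt (by norm_num)
  have hσ2 : σ ≤ 1 / 2 := (min_le_right _ _).trans (by norm_num)
  obtain ⟨hprob, hmain⟩ := hσ σ hσpos hσlt
  -- constants
  have hHW : 1 ≤ HW := one_le_HW
  set L : ℝ := 1 + HW with hL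
  have hLpos : 0 < L := by positivity
  set η : ℝ := 1 / (2 * L) with hη
  have hηpos : 0 < η := by positivity
  have hLη : L * η = 1 / 2 := by rw [hη]; field_simp
  have hballm : MeasurableSet {v : V3 | ‖v‖ ^ 2 < η} :=
    measurableSet_lt (continuous_norm.pow 2).measurable measurable_const
  set q : ℝ≥0∞ := stdGaussian V3 {v : V3 | ‖v‖ ^ 2 < η} with hq
  have hqpos : 0 < q :=
    stdGaussian_pos_of_isOpen (isOpen_lt (continuous_norm.pow 2) continuous_const) ⟨0, by simp [hηpos]⟩
  have hqtop : q ≠ ∞ := measure_ne_top _ _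
  have hq1 : q ≤ 1 := prob_le_one
  set qr : ℝ := q.toReal with hqr
  have hqrpos : 0 < qr := ENNReal.toReal_pos hqpos.ne' hqtop
  have hqr1 : qr ≤ 1 := ENNReal.toReal_le_of_le_ofReal zero_le_one (by simpa using hq1)
  have hlogle : Real.log qr ≤ 0 := Real.log_nonpos hqrpos.le hqr1
  set K : ℝ := 2 - 2 * Real.log qr with hK
  have hKpos : 0 < K := by rw [hK]; linarith
  -- the observable `g = K • hW`
  set g : V3 → ℝ := fun v => K * hW v with hg
  have hgc : Continuous g := continuous_const.mul continuous_hW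
  have hgb : ∃ K' : ℝ, ∀ v, |g v| ≤ K' := ⟨K * HW, fun v => by
    rw [hg, abs_mul, abs_of_pos hKpos]
    exact mul_le_mul_of_nonneg_left (abs_hW_le v) hKpos.le⟩
  have hgo : ∀ (c₀ c₂ : ℝ) (b : V3),
      ∫ v, g v * (c₀ + inner ℝ b v + c₂ * ‖v‖ ^ 2) ∂stdGaussian V3 = 0 := by
    intro c₀ c₂ b
    simp only [hg, mul_assoc]
    rw [integral_const_mul, hW_orthogonal, mul_zero]
  obtain ⟨τ₀, hτ₀, N₀, hN⟩ := hmain (fun _ => 1) g continuous_const hgc (fun _ => by simp) hgb hgo 1 one_pos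
  obtain ⟨Φ⟩ := nonempty_flow hσpos hσhalf N₀
  obtain ⟨lag, hlag, W, hWm, ⟨C, hC⟩, h1, _h2⟩ := hN N₀ le_rfl Φ
  haveI := hprob N₀ Φ
  set G := localGibbsLaw σ (fun _ => (1 : ℝ)) (fun _ => (0 : V3)) (fun _ => (1 : ℝ)) N₀ Φ with hGdef
  have hT : MeasurePreserving (Φ.flow lag) G G := measurePreserving_flow_localGibbsLaw 1 1 N₀ Φ lag
  -- per-particle inequality
  have hgv : ∀ v : V3, K - K * L * ‖v‖ ^ 2 ≤ g v := by
    intro v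
    by_cases hv : ‖v‖ ^ 2 ≤ 1
    · rw [hg]
      simp only [hW_eq_one hv, mul_one]
      nlinarith [sq_nonneg ‖v‖, mul_pos hKpos hLpos]
    · have hv : 1 < ‖v‖ ^ 2 := lt_of_not_ge hv
      have h1 : -HW ≤ hW v := (neg_abs_le _).trans' (neg_le_neg (abs_hW_le v))
      have h2 : K * -HW ≤ K * hW v := mul_le_mul_of_nonneg_left h1 hKpos.le
      have h3 : K * L * 1 ≤ K * L * ‖v‖ ^ 2 := mul_le_mul_of_nonneg_left hv.le (by positivity)
      rw [hg]
      simp only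
      rw [hL] at h3 ⊢
      nlinarith
  -- the band and its invariance
  set B : Set (Config (N₀ + 1) (Fin 3) T3) := {z | configEnergy z ≤ (N₀ + 1) * η / 2} with hB
  have hBm : MeasurableSet B := measurableSet_le (measurable_configEnergy _) measurable_const
  have hBinv : (Φ.flow lag) ⁻¹' B =ᵐ[G] B := by
    have hgood : ∀ᵐ z ∂G, z ∈ Φ.good := by
      rw [hGdef, localGibbsLaw_eq]
      exact (localGibbsMeasure_absolutelyContinuous σ _ _ _ N₀ Φ).ae_le Φ.ae_mem_good
    filter_upwards [hgood] with z hz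
    simp only [eq_iff_iff]
    show Φ.flow lag z ∈ B ↔ z ∈ B
    simp only [hB, mem_setOf_eq, Φ.configEnergy_flow hz lag]
  -- on the band, `2F ≥ K(N+1)`
  have hFB : ∀ z ∈ B, K * (N₀ + 1) ≤
      2 * ∑ i, (fun _ : T3 => (1 : ℝ)) (z i).1 * g ((Real.sqrt 1)⁻¹ • ((z i).2 - 0)) := by
    intro z hz
    have hzE : ∑ i, ‖(z i).2‖ ^ 2 ≤ (N₀ + 1) * η := by
      have : configEnergy z = 2⁻¹ * ∑ i, ‖(z i).2‖ ^ 2 := rfl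
      rw [hB, mem_setOf_eq, this] at hz
      linarith
    have hsum : ∑ i, (K - K * L * ‖(z i).2‖ ^ 2) ≤ ∑ i : Fin (N₀ + 1), g (z i).2 :=
      Finset.sum_le_sum fun i _ => hgv _
    rw [Finset.sum_sub_distrib, Finset.sum_const, Finset.card_univ, Fintype.card_fin, nsmul_eq_mul,
      ← Finset.mul_sum] at hsum
    have hsimp : ∀ i : Fin (N₀ + 1), (fun _ : T3 => (1 : ℝ)) (z i).1 * g ((Real.sqrt 1)⁻¹ • ((z i).2 - 0)) =
        g (z i).2 := by
      intro i
      simp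
    simp only [hsimp]
    have hKL : K * L * ∑ i, ‖(z i).2‖ ^ 2 ≤ K * L * ((N₀ + 1) * η) := mul_le_mul_of_nonneg_left hzE (by positivity)
    have : K * L * ((N₀ + 1) * η) = K * (N₀ + 1) / 2 := by
      rw [show K * L * ((N₀ + 1) * η) = K * (N₀ + 1) * (L * η) by ring, hLη]
      ring
    push_cast at hsum ⊢
    linarith
  -- mass of the band
  have hmass : q ^ (N₀ + 1) ≤ G B := by
    have hCsub : {z : Config (N₀ + 1) (Fin 3) T3 | ∀ i, ‖(z i).2‖ ^ 2 < η} ⊆ B := by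
      intro z hz
      rw [hB, mem_setOf_eq]
      have : ∑ i, ‖(z i).2‖ ^ 2 ≤ ∑ _i : Fin (N₀ + 1), η := Finset.sum_le_sum fun i _ => (hz i).le
      rw [Finset.sum_const, Finset.card_univ, Fintype.card_fin, nsmul_eq_mul] at this
      have hE : configEnergy z = 2⁻¹ * ∑ i, ‖(z i).2‖ ^ 2 := rfl
      rw [hE]
      push_cast at this ⊢
      linarith
    have hCm : MeasurableSet {z : Config (N₀ + 1) (Fin 3) T3 | ∀ i, ‖(z i).2‖ ^ 2 < η} := by
      have : {z : Config (N₀ + 1) (Fin 3) T3 | ∀ i, ‖(z i).2‖ ^ 2 < η} = ⋂ i, {z | ‖(z i).2‖ ^ 2 < η} := by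
        ext z; simp
      rw [this]
      exact MeasurableSet.iInter fun i =>
        measurableSet_lt ((measurable_pi_apply i).snd.norm.pow_const 2) measurable_const
    have hprod : ∀ z : Config (N₀ + 1) (Fin 3) T3, (∏ i, {v : V3 | ‖v‖ ^ 2 < η}.indicator (1 : V3 → ℝ≥0∞) (z i).2) =
        {z : Config (N₀ + 1) (Fin 3) T3 | ∀ i, ‖(z i).2‖ ^ 2 < η}.indicator 1 z := by
      intro z
      by_cases hz : ∀ i, ‖(z i).2‖ ^ 2 < η
      · rw [indicator_of_mem (show z ∈ {z : Config (N₀ + 1) (Fin 3) T3 | ∀ i, ‖(z i).2‖ ^ 2 < η} from hz)]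
        simp only [Pi.one_apply]
        exact Finset.prod_eq_one fun i _ => by rw [indicator_of_mem (show (z i).2 ∈ _ from hz i)]; rfl
      · rw [indicator_of_notMem (show z ∉ {z : Config (N₀ + 1) (Fin 3) T3 | ∀ i, ‖(z i).2‖ ^ 2 < η} from hz)]
        obtain ⟨i, hi⟩ := not_forall.1 hz
        exact Finset.prod_eq_zero (Finset.mem_univ i) (by rw [indicator_of_notMem (show (z i).2 ∉ _ from hi)])
    calc q ^ (N₀ + 1) = ∫⁻ z, ∏ i, {v : V3 | ‖v‖ ^ 2 < η}.indicator (1 : V3 → ℝ≥0∞) (z i).2 ∂G := by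
          rw [hGdef, localGibbsLaw_eq, lintegral_prod_vel_localGibbsMeasure one_pos one_pos 0 hσ2 N₀
            (measurable_one.indicator hballm), gaussMeasure_zero_one, lintegral_indicator_one hballm]
      _ = G {z : Config (N₀ + 1) (Fin 3) T3 | ∀ i, ‖(z i).2‖ ^ 2 < η} := by
          simp_rw [hprod]
          rw [lintegral_indicator_one hCm]
      _ ≤ G B := measure_mono hCsub
  have hGBpos : 0 < G B := (ENNReal.pow_pos hqpos _).trans_le hmass
  have hGB0 : G B ≠ 0 := hGBpos.ne'
  have hGBtop : G B ≠ ∞ := measure_ne_top _ _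
  -- conditional Jensen on the band
  have hlow : ENNReal.ofReal (Real.exp (K * (N₀ + 1))) * G B ≤
      ∫⁻ z, ENNReal.ofReal (Real.exp (2 * ((∑ i, (fun _ : T3 => (1 : ℝ)) (z i).1 *
        g ((Real.sqrt 1)⁻¹ • ((z i).2 - 0))) - lag⁻¹ * (W (Φ.flow lag z) - W z)))) ∂G := by
    set μB : Measure (Config (N₀ + 1) (Fin 3) T3) := (G B)⁻¹ • G.restrict B with hμB
    haveI : IsProbabilityMeasure μB := ⟨by
      rw [hμB, Measure.smul_apply, Measure.restrict_apply_univ, smul_eq_mul,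
        ENNReal.inv_mul_cancel hGB0 hGBtop]⟩
    have hTB : MeasurePreserving (Φ.flow lag) μB μB := by
      have h1 := hT.restrict_preimage hBm
      rw [Measure.restrict_congr_set hBinv] at h1
      rw [hμB]
      exact h1.smul_measure _
    have hJ := ofReal_exp_le_lintegral_exp_sub_coboundary hTB hWm hC (K * (N₀ + 1)) (2 * lag⁻¹)
    rw [hμB, lintegral_smul_measure, smul_eq_mul] at hJ
    have hJ' : ENNReal.ofReal (Real.exp (K * (N₀ + 1))) * G B ≤
        ∫⁻ z in B, ENNReal.ofReal (Real.exp (K * (N₀ + 1) - 2 * lag⁻¹ * (W (Φ.flow lag z) - W z))) ∂G := by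
      have h2 : ENNReal.ofReal (Real.exp (K * (N₀ + 1))) * G B ≤
          ((G B)⁻¹ * ∫⁻ z in B, ENNReal.ofReal
            (Real.exp (K * (N₀ + 1) - 2 * lag⁻¹ * (W (Φ.flow lag z) - W z))) ∂G) * G B := by
        gcongr
      rwa [mul_comm ((G B)⁻¹) _, mul_assoc, ENNReal.inv_mul_cancel hGB0 hGBtop, mul_one] at h2
    refine hJ'.trans ((setLIntegral_mono' hBm fun z hz => ?_).trans (setLIntegral_le_lintegral B _))
    refine ENNReal.ofReal_le_ofReal (Real.exp_le_exp.2 ?_)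
    have := hFB z hz
    nlinarith [this]
  have hfinal : ENNReal.ofReal (Real.exp (K * (N₀ + 1))) * q ^ (N₀ + 1) ≤
      ENNReal.ofReal (Real.exp (1 * (N₀ + 1))) :=
    (le_trans (by gcongr) hlow).trans h1
  have hqofReal : q = ENNReal.ofReal qr := (ENNReal.ofReal_toReal hqtop).symm
  rw [hqofReal, ← ENNReal.ofReal_pow hqrpos.le, ← ENNReal.ofReal_mul (Real.exp_pos _).le,
    ENNReal.ofReal_le_ofReal_iff (Real.exp_pos _).le] at hfinal
  have hexpr : Real.exp (K * (N₀ + 1)) * qr ^ (N₀ + 1) = Real.exp ((N₀ + 1) * (K + Real.log qr)) := by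
    rw [← Real.exp_log (pow_pos hqrpos (N₀ + 1)), ← Real.exp_add, Real.log_pow]
    push_cast
    ring_nf
  rw [hexpr, Real.exp_le_exp] at hfinal
  have hN : (0 : ℝ) < N₀ + 1 := by positivity
  rw [hK] at hfinal
  nlinarith [mul_pos hN (show (0 : ℝ) < 1 - Real.log qr by linarith)]

end AmplitudeRefutation

end Summit.AtomisticToContinuum.HydrodynamicLimit.Theorems.CorrectorPressureDecayNegative.Amplitude
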